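import Mathlib
import HarnessLib
import Summits.HubbardSuperconductivity.HubbardSuperconductivity.Theorems.KLProgrammeForwardBubbleSoftSharpZS
import Summits.HubbardSuperconductivity.HubbardSuperconductivity.Theorems.KLProgrammeMatsubaraSlicePropagatorPath

/-!
# Route `KLProgramme` — ENGINE item stmt-HubbardSuperconductivity-20437 `KLRegimeEngineV17F2`, class-#5 STEP (X).3 pinned pair «88b» /
# located-risk #14, factor (γ)-TR (count split): the SOFT forward slice bubble with the sharp zero-sound term and the transfer shift's Matsubara count
# kept SPLIT into its flat part `(64/π)` and its thermal part `(48/π)·((π/β)/Λ_n)`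
# (cell gate-hubbard-kl, seat hubbard-kl-k3c2-p2 g22, technique «thermal-bar induction n ≤ nScales β + 1 with EngineBoundsAtV4S sums»)

Text-faithful twins (suffix `TC`) of `klfs_transfer_norm_le_of_lipschitz_core/…/klfs_planar_bubble_norm_le_of_lipschitz` with the zero-transfer part from
`klte_slice_bubble_weighted_norm_le_sharp` and the shift from `klfs_shift_norm_le_of_lipschitz_split`: the transfer term `(256/π)·M_f·B_W·(K′Λ)·D` becomes
`(64/π)·M_f·B_W·(K′Λ)·D + (48/π)·M_f·B_W·(K′Λ)·D·((π/β)/Λ)` (flat entry ÷4, the rest is `thermalBar`-shaped); hypotheses unchanged.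
Pure analysis on the tree's objects; nothing about the model is asserted; nothing asserts (X).3, (c), K3 or superconductivity.
References: BGM 2006 §2.5 (2.56b)–(2.56e) [cite: BenfattoGiulianiMastropietro2006].
-/

noncomputable section

namespace Summit.HubbardSuperconductivity.HubbardSuperconductivity.Theorems.KLRegimeSplit

set_option linter.dupNamespace false -- summit = problem name (single-conjunct summit), D-0017

open Real Set Filter MeasureTheory intervalIntegral Complex Literature.MathematicalPhysics.QuantumLattice
open Literature.MathematicalPhysics.QuantumLattice.BandSectorCounting Literature.Probability.LatticeModels
open Summit.HubbardSuperconductivity.HubbardSuperconductivity.Theorems.PerturbedFermiCurve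
open Summit.HubbardSuperconductivity.HubbardSuperconductivity.Theorems.KLProgrammeLegKernels

/-! ## §1 The bubble at transfer: sharp zero-transfer part + split shift -/

section Transfer
variable {f f' : ℝ → ℂ} {Lf Mf LF MF ℓ K' : ℝ} {W : ℝ → ℂ} {σ : ℝ → ℝ} {LW BW δmax : ℝ}

/-- **The slice bubble AT TRANSFER with the second line given by its joint Lipschitz constant (global form).**  As
`klsp_slice_bubble_transfer_norm_le` but the second weight `f'` is only asked to make `Φ_{f'}` jointly `K'`-Lipschitz (no support / no own
Lipschitz hypothesis); the product `F = f·f'` carries the zero-transfer hypotheses (`‖F‖ ≤ M_F`, `Lip F ≤ ℓ/Λ_n²`; its support comes from `f`);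
`W` continuous with `‖W(e) − W(0)‖ ≤ L_W|e|`, `‖W‖ ≤ B_W` on `|e| < 4Λ_n`; shift `σ` continuous, `|σ| ≤ δ_max`. -/
theorem klfs_transfer_norm_le_of_lipschitz_coreTC
    (hlip : ∀ s s', ‖f s - f s'‖ ≤ Lf * |s - s'|) (hbd : ∀ s, ‖f s‖ ≤ Mf) {n : ℕ}
    (hin : ∀ s, s ≤ (klScale klE0 n / 2) ^ 2 → f s = 0) (hout : ∀ s, (4 * klScale klE0 n) ^ 2 ≤ s → f s = 0)
    (hK' : 0 ≤ K') (hΨlip : ∀ k₀ e k₀' e', ‖klfb_prop f' k₀ e - klfb_prop f' k₀' e'‖ ≤ K' * (|k₀ - k₀'| + |e - e'|))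
    (hMF : 0 ≤ MF) (hFlip : ∀ s s', ‖f s * f' s - f s' * f' s'‖ ≤ LF * |s - s'|) (hFbd : ∀ s, ‖f s * f' s‖ ≤ MF)
    (hLF : LF ≤ ℓ / klScale klE0 n ^ 2)
    (hW : Continuous W) (hLW : 0 ≤ LW) (hBW : 0 ≤ BW)
    (hWlip : ∀ e : ℝ, |e| < 4 * klScale klE0 n → ‖W e - W 0‖ ≤ LW * |e|)
    (hWbd : ∀ e, |e| < 4 * klScale klE0 n → ‖W e‖ ≤ BW)
    (hσc : Continuous σ) (hδ0 : 0 ≤ δmax) (hσ : ∀ e, |σ e| ≤ δmax)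
    (q₀ : ℝ) {β : ℝ} (hβ : klBetaMin ≤ β) (hn : n ≤ nScales β + 1) {M : ℕ}
    (hM : β * (4 * klScale klE0 n) / (2 * Real.pi) + 1 ≤ M) :
    ‖β⁻¹ • ∑ i : MatsubaraIdx M, ∫ e,
        W e * klfb_prop f (matsubaraFreq β M i) e * klfb_prop f' (matsubaraFreq β M i + q₀) (e + σ e)‖ ≤
      64 / Real.pi * MF * LW * klScale klE0 n +
        393216 / Real.pi * (ℓ + 8 * MF) * BW * ((Real.pi / β) / klScale klE0 n) +
          (64 / Real.pi * Mf * BW * (K' * klScale klE0 n) * (|q₀| + δmax) +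
            48 / Real.pi * Mf * BW * (K' * klScale klE0 n) * (|q₀| + δmax) * ((Real.pi / β) / klScale klE0 n)) := by
  set Λ := klScale klE0 n with hΛdef
  have hΛ : 0 < Λ := klth_klScale_pos n
  have hr₁ : 0 < Λ / 2 := by positivity
  have hr : 0 < 4 * Λ := by positivity
  set ω : MatsubaraIdx M → ℝ := fun i => matsubaraFreq β M i with hω
  -- continuity in `e` of the factors
  have hΦc : ∀ k₀, Continuous fun e => klfb_prop f k₀ e := fun k₀ => klfb_continuous_prop_snd hlip hbd hin hout hr₁ hr k₀
  have hΨc : ∀ k₀, Continuous fun e => klfb_prop f' k₀ e := fun k₀ => klfs_continuous_snd_of_lipschitz hΨlip k₀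
  have hΨsc : ∀ k₀, Continuous fun e => klfb_prop f' (k₀ + q₀) (e + σ e) := fun k₀ =>
    (hΨc (k₀ + q₀)).comp (continuous_id.add hσc)
  have hΦzero : ∀ k₀ e, 4 * Λ ≤ |e| → klfb_prop f k₀ e = 0 := fun k₀ e he => klfb_prop_eq_zero_of_le_abs hr.le hout k₀ he
  -- integrability of the two pieces of each slice
  have hint1 : ∀ k₀ : ℝ, Integrable fun e : ℝ => W e * klfb_prop f k₀ e * klfb_prop f' k₀ e := by
    intro k₀
    have hcont : Continuous fun e : ℝ => W e * klfb_prop f k₀ e * klfb_prop f' k₀ e := (hW.mul (hΦc k₀)).mul (hΨc k₀)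
    refine hcont.integrable_of_hasCompactSupport ?_
    refine HasCompactSupport.intro (isCompact_Icc (a := -(4 * Λ)) (b := 4 * Λ)) fun e he => ?_
    rw [hΦzero k₀ e (klsp_le_abs_of_not_mem_Icc he), mul_zero, zero_mul]
  have hint2 : ∀ k₀ : ℝ, Integrable fun e : ℝ =>
      W e * klfb_prop f k₀ e * (klfb_prop f' (k₀ + q₀) (e + σ e) - klfb_prop f' k₀ e) := by
    intro k₀
    have hcont : Continuous fun e : ℝ => W e * klfb_prop f k₀ e * (klfb_prop f' (k₀ + q₀) (e + σ e) - klfb_prop f' k₀ e) :=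
      (hW.mul (hΦc k₀)).mul ((hΨsc k₀).sub (hΨc k₀))
    refine hcont.integrable_of_hasCompactSupport ?_
    refine HasCompactSupport.intro (isCompact_Icc (a := -(4 * Λ)) (b := 4 * Λ)) fun e he => ?_
    rw [hΦzero k₀ e (klsp_le_abs_of_not_mem_Icc he), mul_zero, zero_mul]
  -- split each slice
  have hsplit : ∀ i : MatsubaraIdx M,
      (∫ e, W e * klfb_prop f (ω i) e * klfb_prop f' (ω i + q₀) (e + σ e)) =
        (∫ e, W e * klfb_prop f (ω i) e * klfb_prop f' (ω i) e) +
          ∫ e, W e * klfb_prop f (ω i) e * (klfb_prop f' (ω i + q₀) (e + σ e) - klfb_prop f' (ω i) e) := by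
    intro i
    rw [← integral_add (hint1 (ω i)) (hint2 (ω i))]
    refine integral_congr_ae (Filter.Eventually.of_forall fun e => ?_)
    simp only
    ring
  -- the zero-transfer integrand in the carrier's form
  have hzero_form : ∀ (k₀ e : ℝ), W e * klfb_prop f k₀ e * klfb_prop f' k₀ e =
      (f (k₀ ^ 2 + e ^ 2) * f' (k₀ ^ 2 + e ^ 2)) * ((-I * k₀ + e) ^ 2)⁻¹ * W e := by
    intro k₀ e
    simp only [klfb_prop]
    rw [klsp_div_propagator_eq f k₀ e, klsp_div_propagator_eq f' k₀ e]
    rw [show ((-I * (k₀ : ℂ) + e) ^ 2)⁻¹ = (-I * k₀ + e)⁻¹ * (-I * k₀ + e)⁻¹ by rw [sq, mul_inv]]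
    ring
  have hsum : (β⁻¹ • ∑ i : MatsubaraIdx M, ∫ e, W e * klfb_prop f (ω i) e * klfb_prop f' (ω i + q₀) (e + σ e)) =
      β⁻¹ • (∑ i : MatsubaraIdx M, ∫ e, (f (ω i ^ 2 + e ^ 2) * f' (ω i ^ 2 + e ^ 2)) * ((-I * (ω i) + e) ^ 2)⁻¹ * W e) +
        β⁻¹ • ∑ i : MatsubaraIdx M, ∫ e,
          W e * klfb_prop f (ω i) e * (klfb_prop f' (ω i + q₀) (e + σ e) - klfb_prop f' (ω i) e) := by
    rw [← smul_add, ← Finset.sum_add_distrib]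
    congr 1
    refine Finset.sum_congr rfl fun i _ => ?_
    rw [hsplit i]
    congr 1
    refine integral_congr_ae (Filter.Eventually.of_forall fun e => ?_)
    exact hzero_form (ω i) e
  have h1 := klte_slice_bubble_weighted_norm_le_sharp (F := fun s => f s * f' s) (W := W) hMF hFlip hFbd hLF
    (fun s hs => by simp only [hin s hs, zero_mul]) (fun s hs => by simp only [hout s hs, zero_mul])
    hW hLW hBW hWlip hWbd hβ hn hM
  have hβ0 : 0 < β := pos_of_klBetaMin_le hβ
  have h2 := klfs_shift_norm_le_of_lipschitz_split (Ψ := klfb_prop f') hbd hin hout hK' hΨlip hBW hWbd hδ0 hσ q₀ hβ0 M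
  change ‖β⁻¹ • ∑ i : MatsubaraIdx M, ∫ e, W e * klfb_prop f (ω i) e * klfb_prop f' (ω i + q₀) (e + σ e)‖ ≤ _
  rw [hsum]
  refine (norm_add_le _ _).trans ?_
  exact add_le_add h1 h2


/-- **Window form** of `klfs_transfer_norm_le_of_lipschitz_core`: `W` and the shift `σ` only continuous / bounded ON `[−4Λ_n, 4Λ_n]`
(clamping, as in `…MatsubaraSliceBubbleWindow`). -/
theorem klfs_transfer_norm_le_of_lipschitzTC
    (hlip : ∀ s s', ‖f s - f s'‖ ≤ Lf * |s - s'|) (hbd : ∀ s, ‖f s‖ ≤ Mf) {n : ℕ}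
    (hin : ∀ s, s ≤ (klScale klE0 n / 2) ^ 2 → f s = 0) (hout : ∀ s, (4 * klScale klE0 n) ^ 2 ≤ s → f s = 0)
    (hK' : 0 ≤ K') (hΨlip : ∀ k₀ e k₀' e', ‖klfb_prop f' k₀ e - klfb_prop f' k₀' e'‖ ≤ K' * (|k₀ - k₀'| + |e - e'|))
    (hMF : 0 ≤ MF) (hFlip : ∀ s s', ‖f s * f' s - f s' * f' s'‖ ≤ LF * |s - s'|) (hFbd : ∀ s, ‖f s * f' s‖ ≤ MF)
    (hLF : LF ≤ ℓ / klScale klE0 n ^ 2)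
    (hW : ContinuousOn W (Icc (-(4 * klScale klE0 n)) (4 * klScale klE0 n))) (hLW : 0 ≤ LW) (hBW : 0 ≤ BW)
    (hWlip : ∀ e : ℝ, |e| < 4 * klScale klE0 n → ‖W e - W 0‖ ≤ LW * |e|)
    (hWbd : ∀ e, |e| < 4 * klScale klE0 n → ‖W e‖ ≤ BW)
    (hσc : ContinuousOn σ (Icc (-(4 * klScale klE0 n)) (4 * klScale klE0 n))) (hδ0 : 0 ≤ δmax)
    (hσ : ∀ e, |e| ≤ 4 * klScale klE0 n → |σ e| ≤ δmax)
    (q₀ : ℝ) {β : ℝ} (hβ : klBetaMin ≤ β) (hn : n ≤ nScales β + 1) {M : ℕ}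
    (hM : β * (4 * klScale klE0 n) / (2 * Real.pi) + 1 ≤ M) :
    ‖β⁻¹ • ∑ i : MatsubaraIdx M, ∫ e,
        W e * klfb_prop f (matsubaraFreq β M i) e * klfb_prop f' (matsubaraFreq β M i + q₀) (e + σ e)‖ ≤
      64 / Real.pi * MF * LW * klScale klE0 n +
        393216 / Real.pi * (ℓ + 8 * MF) * BW * ((Real.pi / β) / klScale klE0 n) +
          (64 / Real.pi * Mf * BW * (K' * klScale klE0 n) * (|q₀| + δmax) +
            48 / Real.pi * Mf * BW * (K' * klScale klE0 n) * (|q₀| + δmax) * ((Real.pi / β) / klScale klE0 n)) := by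
  set r := 4 * klScale klE0 n with hr_def
  have hΛ := klth_klScale_pos n
  have hr : 0 ≤ r := by positivity
  set W' : ℝ → ℂ := fun e => W (max (-r) (min r e)) with hW'
  set σ' : ℝ → ℝ := fun e => σ (max (-r) (min r e)) with hσ'
  have hW'c : Continuous W' := klsw_continuous_comp_clamp hr hW
  have hσ'c : Continuous σ' := klsw_continuous_comp_clamp hr hσc
  have hW'eq : ∀ e, |e| < r → W' e = W e := fun e he => by simp only [hW', Literature.Analysis.FunctionSpaces.max_neg_min_eq_self he.le]
  have hσ'eq : ∀ e, |e| < r → σ' e = σ e := fun e he => by simp only [hσ', Literature.Analysis.FunctionSpaces.max_neg_min_eq_self he.le]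
  have hW'0 : W' 0 = W 0 := by
    simp only [hW', Literature.Analysis.FunctionSpaces.max_neg_min_eq_self (show |(0:ℝ)| ≤ r by simpa using hr)]
  have hW'lip : ∀ e : ℝ, |e| < r → ‖W' e - W' 0‖ ≤ LW * |e| := fun e he => by rw [hW'eq e he, hW'0]; exact hWlip e he
  have hW'bd : ∀ e : ℝ, |e| < r → ‖W' e‖ ≤ BW := fun e he => by rw [hW'eq e he]; exact hWbd e he
  have hσ'bd : ∀ e, |σ' e| ≤ δmax := fun e =>
    hσ _ (abs_le.mpr ⟨(klsw_clamp_mem hr e).1, (klsw_clamp_mem hr e).2⟩)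
  have hΦzero : ∀ (k₀ e : ℝ), r ≤ |e| → klfb_prop f k₀ e = 0 := fun k₀ e he => klfb_prop_eq_zero_of_le_abs hr hout k₀ he
  have hpt : ∀ (k₀ e : ℝ), W e * klfb_prop f k₀ e * klfb_prop f' (k₀ + q₀) (e + σ e) =
      W' e * klfb_prop f k₀ e * klfb_prop f' (k₀ + q₀) (e + σ' e) := by
    intro k₀ e
    by_cases he : |e| < r
    · rw [hW'eq e he, hσ'eq e he]
    · rw [hΦzero k₀ e (not_lt.mp he), mul_zero, zero_mul, mul_zero, zero_mul]
  simp_rw [hpt]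
  exact klfs_transfer_norm_le_of_lipschitz_coreTC hlip hbd hin hout hK' hΨlip hMF hFlip hFbd hLF hW'c hLW hBW hW'lip hW'bd hσ'c hδ0
    hσ'bd q₀ hβ hn hM
end Transfer

/-! ## §2 On the frame band: per-ray and planar bounds -/

section Frame
variable {a b : ℝ} (B : BandBounds a b) {δ : (Fin 2 → ℝ) → ℝ} (hδ1 : ContDiff ℝ 1 δ) {κ₀ κ₁ : ℝ}
  (hδ : ∀ k : Fin 2 → ℝ, (∀ i, |k i| ≤ π) → |δ k| ≤ κ₀)
  (hκ : ∀ k : Fin 2 → ℝ, (∀ i, |k i| ≤ π) → ‖fderiv ℝ δ k‖ ≤ κ₁) (hκ₁ : κ₁ < B.Dtmin)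

include B hδ1 hδ hκ hκ₁ in
/-- **THE FORWARD SLICE BUBBLE ON ONE RAY, second line by its joint Lipschitz constant `K'`** (zero-sound remainder + thermal layer + shift):
as `klfb_ray_bubble_norm_le` with the `f'`-hypotheses replaced by `hΨlip` and the shift term `(256/π)·M_f·B_W·(K'Λ_n)·(|q₀| + δ_max)`. -/
theorem klfs_ray_bubble_norm_le_of_lipschitzTC {A : ℝ × ℝ → ℂ} (hA : Continuous A)
    (hAsupp : ∀ p : ℝ × ℝ, A p ≠ 0 → |p.1| < π ∧ |p.2| < π) {A₀ A₁ : ℝ} (hA0 : ∀ p, ‖A p‖ ≤ A₀)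
    (hA1 : ∀ θ t t' : ℝ, 0 ≤ t → 0 ≤ t' →
      ‖A (t * Real.cos θ, t * Real.sin θ) - A (t' * Real.cos θ, t' * Real.sin θ)‖ ≤ A₁ * |t - t'|)
    {κ₂ : ℝ} (hκ₂ : 0 ≤ κ₂)
    (hD2 : ∀ θ s t : ℝ, s ∈ Icc 0 (π / ‖dir θ‖) → t ∈ Icc 0 (π / ‖dir θ‖) →
      |fderiv ℝ δ (s • dir θ) (dir θ) - fderiv ℝ δ (t • dir θ) (dir θ)| ≤ κ₂ * |s - t|)
    {f f' : ℝ → ℂ} {Lf Mf K' LF MF ℓ : ℝ} {n : ℕ}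
    (hlip : ∀ s s', ‖f s - f s'‖ ≤ Lf * |s - s'|) (hbd : ∀ s, ‖f s‖ ≤ Mf)
    (hin : ∀ s, s ≤ (klScale klE0 n / 2) ^ 2 → f s = 0) (hout : ∀ s, (4 * klScale klE0 n) ^ 2 ≤ s → f s = 0)
    (hK' : 0 ≤ K') (hΨlip : ∀ k₀ e k₀' e', ‖klfb_prop f' k₀ e - klfb_prop f' k₀' e'‖ ≤ K' * (|k₀ - k₀'| + |e - e'|))
    (hMF : 0 ≤ MF) (hFlip : ∀ s s', ‖f s * f' s - f s' * f' s'‖ ≤ LF * |s - s'|) (hFbd : ∀ s, ‖f s * f' s‖ ≤ MF)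
    (hLF : LF ≤ ℓ / klScale klE0 n ^ 2)
    {e' : ℝ × ℝ → ℝ} (he' : Continuous e') {μ δmax : ℝ} (hδ0 : 0 ≤ δmax)
    (he'δ : ∀ p : ℝ × ℝ, |p.1| < π → |p.2| < π → |e' p - klfb_band δ μ p| ≤ δmax)
    (hlo : a < μ - 4 * klScale klE0 n - κ₀) (hhi : μ + 4 * klScale klE0 n + κ₀ < b)
    (q₀ : ℝ) {β : ℝ} (hβ : klBetaMin ≤ β) (hn : n ≤ nScales β + 1) {M : ℕ}
    (hM : β * (4 * klScale klE0 n) / (2 * Real.pi) + 1 ≤ M) (θ : ℝ) :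
    ‖β⁻¹ • ∑ i : MatsubaraIdx M, ∫ t in Ioi (0 : ℝ),
        t • klfb_integrand δ μ A f f' e' (matsubaraFreq β M i) q₀ (t * Real.cos θ, t * Real.sin θ)‖ ≤
      64 / Real.pi * MF *
          (Real.pi * Real.sqrt 2 / (B.Dtmin - κ₁) * A₁ / (B.Dtmin - κ₁) +
            A₀ * (1 / (B.Dtmin - κ₁) ^ 2 + Real.pi * Real.sqrt 2 * (2 + κ₂) / (B.Dtmin - κ₁) ^ 3)) * klScale klE0 n +
        393216 / Real.pi * (ℓ + 8 * MF) * (A₀ * (Real.pi * Real.sqrt 2 / (B.Dtmin - κ₁))) * ((Real.pi / β) / klScale klE0 n) +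
          (64 / Real.pi * Mf * (A₀ * (Real.pi * Real.sqrt 2 / (B.Dtmin - κ₁))) * (K' * klScale klE0 n) * (|q₀| + δmax) +
            48 / Real.pi * Mf * (A₀ * (Real.pi * Real.sqrt 2 / (B.Dtmin - κ₁))) * (K' * klScale klE0 n) * (|q₀| + δmax) * ((Real.pi / β) / klScale klE0 n)) := by
  have hδc : Continuous δ := hδ1.continuous
  have hΛ := klth_klScale_pos n
  have hr₁ : 0 < klScale klE0 n / 2 := by positivity
  have hr : 0 < 4 * klScale klE0 n := by positivity
  have hd : 0 < B.Dtmin - κ₁ := by linarith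
  have hA0' : 0 ≤ A₀ := (norm_nonneg _).trans (hA0 0)
  have hA1' : 0 ≤ A₁ := klfb_radialLip_nonneg hA1
  have hκ₀ : 0 ≤ κ₀ := (abs_nonneg _).trans (hδ 0 (fun i => by simp [Real.pi_pos.le]))
  have hμlo : a ≤ μ - κ₀ := by linarith
  have hμhi : μ + κ₀ ≤ b := by linarith
  have hray : ∀ i : MatsubaraIdx M, ∫ t in Ioi (0 : ℝ),
      t • klfb_integrand δ μ A f f' e' (matsubaraFreq β M i) q₀ (t * Real.cos θ, t * Real.sin θ) =
        ∫ e : ℝ, klfb_weight δ μ A θ e * klfb_prop f (matsubaraFreq β M i) e *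
          klfb_prop f' (matsubaraFreq β M i + q₀) (e + klfb_shift δ μ e' θ e) := fun i =>
    klfs_ray_bubble_integral_eq B hδ1 hδ hκ hκ₁ hA hAsupp hlip hbd hin hout hr₁ hr hΨlip he' hlo hhi _ q₀ θ
  rw [Finset.sum_congr rfl fun i _ => hray i]
  have hW : ContinuousOn (klfb_weight δ μ A θ) (Icc (-(4 * klScale klE0 n)) (4 * klScale klE0 n)) :=
    klfb_weight_continuousOn B hδ1 hδ hκ hκ₁ hA hlo hhi θ
  have hWlip : ∀ e : ℝ, |e| < 4 * klScale klE0 n → ‖klfb_weight δ μ A θ e - klfb_weight δ μ A θ 0‖ ≤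
      (Real.pi * Real.sqrt 2 / (B.Dtmin - κ₁) * A₁ / (B.Dtmin - κ₁) +
          A₀ * (1 / (B.Dtmin - κ₁) ^ 2 + Real.pi * Real.sqrt 2 * (2 + κ₂) / (B.Dtmin - κ₁) ^ 3)) * |e| := by
    intro e he
    exact klfb_weight_sub_zero_norm_le B hδ1 hδ hκ hκ₁ hA0 hA1 hκ₂ (hD2 θ) hμlo hμhi (by linarith [(abs_lt.mp he).1])
      (by linarith [(abs_lt.mp he).2])
  have hWbd : ∀ e : ℝ, |e| < 4 * klScale klE0 n → ‖klfb_weight δ μ A θ e‖ ≤ A₀ * (Real.pi * Real.sqrt 2 / (B.Dtmin - κ₁)) := by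
    intro e he
    exact klfb_weight_norm_le B hδ hκ hκ₁ hδc hA0 (by linarith [(abs_lt.mp he).1]) (by linarith [(abs_lt.mp he).2]) θ
  have hσc : ContinuousOn (klfb_shift δ μ e' θ) (Icc (-(4 * klScale klE0 n)) (4 * klScale klE0 n)) :=
    klfb_shift_continuousOn B hδ1 hδ hκ hκ₁ he' hlo hhi θ
  have hσ : ∀ e : ℝ, |e| ≤ 4 * klScale klE0 n → |klfb_shift δ μ e' θ e| ≤ δmax := by
    intro e he
    exact klfb_shift_abs_le B hδ hδc he'δ (by linarith [(abs_le.mp he).1]) (by linarith [(abs_le.mp he).2]) θ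
  have hLW : 0 ≤ Real.pi * Real.sqrt 2 / (B.Dtmin - κ₁) * A₁ / (B.Dtmin - κ₁) +
      A₀ * (1 / (B.Dtmin - κ₁) ^ 2 + Real.pi * Real.sqrt 2 * (2 + κ₂) / (B.Dtmin - κ₁) ^ 3) := by positivity
  have hBW : 0 ≤ A₀ * (Real.pi * Real.sqrt 2 / (B.Dtmin - κ₁)) := by positivity
  exact klfs_transfer_norm_le_of_lipschitzTC hlip hbd hin hout hK' hΨlip hMF hFlip hFbd hLF hW hLW hBW hWlip hWbd hσc hδ0 hσ q₀ hβ hn hM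

include B hδ1 hδ hκ hκ₁ in
/-- **THE FORWARD SLICE BUBBLE OF THE FRAME BAND ON THE PLANE, second line by its joint Lipschitz constant `K'`**: as
`klfb_planar_bubble_norm_le` with the shift term `(256/π)·M_f·B_W·(K'Λ_n)·(|q₀| + δ_max)` (times `2π` from the angle). -/
theorem klfs_planar_bubble_norm_le_of_lipschitzTC {A : ℝ × ℝ → ℂ} (hA : Continuous A)
    (hAsupp : ∀ p : ℝ × ℝ, A p ≠ 0 → |p.1| < π ∧ |p.2| < π) {A₀ A₁ : ℝ} (hA0 : ∀ p, ‖A p‖ ≤ A₀)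
    (hA1 : ∀ θ t t' : ℝ, 0 ≤ t → 0 ≤ t' →
      ‖A (t * Real.cos θ, t * Real.sin θ) - A (t' * Real.cos θ, t' * Real.sin θ)‖ ≤ A₁ * |t - t'|)
    {κ₂ : ℝ} (hκ₂ : 0 ≤ κ₂)
    (hD2 : ∀ θ s t : ℝ, s ∈ Icc 0 (π / ‖dir θ‖) → t ∈ Icc 0 (π / ‖dir θ‖) →
      |fderiv ℝ δ (s • dir θ) (dir θ) - fderiv ℝ δ (t • dir θ) (dir θ)| ≤ κ₂ * |s - t|)
    {f f' : ℝ → ℂ} {Lf Mf K' LF MF ℓ : ℝ} {n : ℕ}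
    (hlip : ∀ s s', ‖f s - f s'‖ ≤ Lf * |s - s'|) (hbd : ∀ s, ‖f s‖ ≤ Mf)
    (hin : ∀ s, s ≤ (klScale klE0 n / 2) ^ 2 → f s = 0) (hout : ∀ s, (4 * klScale klE0 n) ^ 2 ≤ s → f s = 0)
    (hK' : 0 ≤ K') (hΨlip : ∀ k₀ e k₀' e', ‖klfb_prop f' k₀ e - klfb_prop f' k₀' e'‖ ≤ K' * (|k₀ - k₀'| + |e - e'|))
    (hMF : 0 ≤ MF) (hFlip : ∀ s s', ‖f s * f' s - f s' * f' s'‖ ≤ LF * |s - s'|) (hFbd : ∀ s, ‖f s * f' s‖ ≤ MF)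
    (hLF : LF ≤ ℓ / klScale klE0 n ^ 2)
    {e' : ℝ × ℝ → ℝ} (he' : Continuous e') {μ δmax : ℝ} (hδ0 : 0 ≤ δmax)
    (he'δ : ∀ p : ℝ × ℝ, |p.1| < π → |p.2| < π → |e' p - klfb_band δ μ p| ≤ δmax)
    (hlo : a < μ - 4 * klScale klE0 n - κ₀) (hhi : μ + 4 * klScale klE0 n + κ₀ < b)
    (q₀ : ℝ) {β : ℝ} (hβ : klBetaMin ≤ β) (hn : n ≤ nScales β + 1) {M : ℕ}
    (hM : β * (4 * klScale klE0 n) / (2 * Real.pi) + 1 ≤ M) :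
    ‖β⁻¹ • ∑ i : MatsubaraIdx M, ∫ p : ℝ × ℝ, klfb_integrand δ μ A f f' e' (matsubaraFreq β M i) q₀ p‖ ≤
      2 * Real.pi *
        (64 / Real.pi * MF *
            (Real.pi * Real.sqrt 2 / (B.Dtmin - κ₁) * A₁ / (B.Dtmin - κ₁) +
              A₀ * (1 / (B.Dtmin - κ₁) ^ 2 + Real.pi * Real.sqrt 2 * (2 + κ₂) / (B.Dtmin - κ₁) ^ 3)) * klScale klE0 n +
          393216 / Real.pi * (ℓ + 8 * MF) * (A₀ * (Real.pi * Real.sqrt 2 / (B.Dtmin - κ₁))) * ((Real.pi / β) / klScale klE0 n) +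
            (64 / Real.pi * Mf * (A₀ * (Real.pi * Real.sqrt 2 / (B.Dtmin - κ₁))) * (K' * klScale klE0 n) * (|q₀| + δmax) +
              48 / Real.pi * Mf * (A₀ * (Real.pi * Real.sqrt 2 / (B.Dtmin - κ₁))) * (K' * klScale klE0 n) * (|q₀| + δmax) * ((Real.pi / β) / klScale klE0 n))) := by
  have hδc : Continuous δ := hδ1.continuous
  have hΛ := klth_klScale_pos n
  have hr₁ : 0 < klScale klE0 n / 2 := by positivity
  have hr : 0 < 4 * klScale klE0 n := by positivity
  have hcs := klfb_hasCompactSupport_of_square hAsupp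
  have hint : ∀ i : MatsubaraIdx M, Integrable (klfb_integrand δ μ A f f' e' (matsubaraFreq β M i) q₀) := by
    intro i
    have hc := klfs_continuous_integrand hδc hA hlip hbd hin hout hr₁ hr hΨlip he' μ (matsubaraFreq β M i) q₀
    refine hc.integrable_of_hasCompactSupport ?_
    unfold klfb_integrand
    exact (hcs.mul_right).mul_right
  exact klry_norm_smul_sum_integral_le_of_ray_bound hint fun θ _ =>
    klfs_ray_bubble_norm_le_of_lipschitzTC B hδ1 hδ hκ hκ₁ hA hAsupp hA0 hA1 hκ₂ hD2 hlip hbd hin hout hK' hΨlip hMF hFlip hFbd hLF he'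
      hδ0 he'δ hlo hhi q₀ hβ hn hM θ
end Frame

end Summit.HubbardSuperconductivity.HubbardSuperconductivity.Theorems.KLRegimeSplit

end
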